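import Summits.QuantumFields.BalabanUV.Beta.CapRouteASchedules
import Summits.QuantumFields.BalabanUV.Beta.CapLatticeBudget
import Mathlib.Analysis.Complex.ExponentialBounds

/-!
# Beta / CapRouteAToy — AN END-TO-END KERNEL INSTANCE OF ROW CAP-k's TYPED TARGET: every binder of
# `CapRouteASchedules.rowsOfOneLoopFormCode16E_routeA₂_ofSchedules` discharged for a toy `1 × 1` stencil family, `0` hypotheses left,
# and the resulting `Rows` term's certified row READ BACK as a kernel inequality on a Brillouin-zone mean
# (β sub-cell, BINDER-OWNERS row CAP-k, lineage `b2b-balaban-beta-an5`, gen 26; node BETA-an5-g26-SCHEDULES, leaf 4 «NON-VACUITY»; journal l.17735)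

The row's typed target has ≈ 25 binders ((N) dictionary, STRUCTURE ×7, `hR`, schedules + per-leaf certificates, fin schedules + per-leaf
certificates, (Z2b) stencil sups, (T) two-engine ball, (A) budget, cmp).  Each anchor of the row is a `def` returning `Rows b`; that the
composition TYPE-CHECKS says nothing about whether the binder list is JOINTLY SATISFIABLE in the conventions actually fixed by the tree
(sign classes of the quarter region, the fin parametrisation, `descend ∘ gridPt` on `code16SetE N`, the direction of the budget inequality,
the cast of `lo`).  THIS LEAF settles that by INHABITING the typed target with NO hypothesis:

* the TOY FAMILY (`d + 1 = 4`, `n = Fin 1`): `toyA q = sym q • 1` with `sym q = 2 + (e^{i q₀} + e^{−i q₀})∕8` (`= 2 + cos q₀ ∕ 4` on real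
  momenta; a stencil family with offsets `{0, ±e₀}`), `B = 1`, `C = D = 0`, shift `c = 0`; strip width `κ = 1`; code16 level `N = 2`;
* EVERY binder discharged in the kernel: `MatTubeHol` ×5 (`TubeHolAlgebra`), `MatNegTranspose`, `MatConjSymm`, `hR` (evenness in `q₀`),
  box schedules `S := leaf` per sign class with `hcert` from `|sym q| ≥ 2 − e∕4 ≥ 1` on the tube `|Im q₀| ≤ 1` (`Real.exp_one_lt_d9`), fin
  schedules `F := leaf` with `hcertF` likewise, stencil sups `1, 0, 0`, the (T) ball `|mean − 1∕2| ≤ 1∕10` from the POINTWISE bound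
  `|(2 + cos θ∕4)⁻¹ − 1∕2| ≤ 1∕14` at the `256` nodes of `code16SetE 2` (`card_code16SetE`), the budget `A₀ = 3∕100` from
  `CapLatticeBudget.budget_code16_param` with `q = 3∕19 ≥ e^{−2}` (`aliasRatioL1_le_inv_partialSum`), and `lo = 1∕3 ≤ 1∕2 − 1∕10 − 3∕100`;
* **`toyRows : Rows toyb`** — the typed target INHABITED; `toyRows_k₀ : toyRows.k₀ = 0`, `toyRows_lo : toyRows.lo 0 = 1∕3`;
* **`third_le_latticeKernel_toy`**: `1∕3 ≤ Re ∫_{BZ} (2 + cos q₀∕4)⁻¹ dq∕(2π)⁴` — the certified row READ BACK through `Rows.lo_le`: the whole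
  chain (structure lemmas → symmetry transports → box∕fin covers → maximum principle → aliasing tail of the code16 rule → budget) composes to
  a closed kernel inequality about a lattice integral (true value `(63∕16)^{−1∕2} = 0.50395…`).

HONEST FRAMING.  A NON-VACUITY ∕ PLUMBING certificate for the row's typed target on a TOY family — it says the binder list is consistent and
shows, binder by binder, which tree lemma discharges each STRUCTURAL binder; it says NOTHING about the cell's `k₀` (SU(2), `L = 3`, `744`
dimensions), whose numerical binders remain uncertified (two engines, GO none); 0 binders of the REAL row instantiated; 0 certified
coefficients.  Discharging `BetaPertH` would make Bałaban's ultraviolet stability unconditional — NOT the continuum limit, NOT the Clay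
problem.  0 `sorry`, 0 cite tags.
-/

namespace Summit.QuantumFields.BalabanUV.Beta.CapRouteAToy

open Complex Set Matrix
open Literature.MathematicalPhysics.QuantumFieldTheory.Balaban1983to89
open B4Strip (Strip ofRealVec)
open B4ContourShift (latticeKernel)
open B4TorusKernel (descend gridPt)
open Beta.AliasingTailL1 (aliasRatioL1)
open Beta.AliasingTailLattice (codeTheta code16SetE card_code16SetE)
open Summit.QuantumFields.BalabanUV.Beta.CapRows (Rows)
open Summit.QuantumFields.BalabanUV.Beta.TubeMaximumModulus
open Summit.QuantumFields.BalabanUV.Beta.PolyRegularAlgebra (character)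
open Summit.QuantumFields.BalabanUV.Beta.VertexToriSymmetry
open Summit.QuantumFields.BalabanUV.Beta.ConjReflectionAlgebra (MatConjSymm conjNeg conjNeg_apply)
open Summit.QuantumFields.BalabanUV.Beta.ResolventBoxCertificate (Box)
open Summit.QuantumFields.BalabanUV.Beta.CoverSchedules
open Summit.QuantumFields.BalabanUV.Beta.CapRouteASchedules (rowsOfOneLoopFormCode16E_routeA₂_ofSchedules
  rowsOfOneLoopFormCode16E_routeA₂_ofSchedules_k₀)
open Summit.QuantumFields.BalabanUV.Beta.CapLatticeBudget (budget_code16_param aliasRatioL1_le_inv_partialSum)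
open scoped Real ComplexConjugate Matrix.Norms.L2Operator

noncomputable section

/-! ## §1 The toy family -/

/-- the toy SYMBOL `sym q = 2 + (e^{i q₀} + e^{−i q₀}) ∕ 8` (`= 2 + cos q₀ ∕ 4` on real momenta). [folklore] -/
def sym (q : Fin 4 → ℂ) : ℂ := 2 + 8⁻¹ * (cexp (I * q 0) + cexp (-(I * q 0)))

/-- the toy `1 × 1` stencil family `toyA q = sym q • 1`. [folklore] -/
def toyA (q : Fin 4 → ℂ) : Matrix (Fin 1) (Fin 1) ℂ := sym q • (1 : Matrix (Fin 1) (Fin 1) ℂ)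

/-- the toy numerator family `B = 1`. [folklore] -/
def toyOne (_ : Fin 4 → ℂ) : Matrix (Fin 1) (Fin 1) ℂ := 1

/-- the toy bubble families `C = D = 0`. [folklore] -/
def toyZero (_ : Fin 4 → ℂ) : Matrix (Fin 1) (Fin 1) ℂ := 0

/-- the toy ONE-LOOP FORM in the anchor's literal shape (`A := toyA`, `B := 1`, `C := D := 0`, shift `c := 0`). [folklore] -/
def toyG (p : Fin 4 → ℂ) : ℂ :=
  ((toyA p)⁻¹ * toyOne p).trace - ((toyA p)⁻¹ * toyZero p * (toyA (p - 0))⁻¹ * toyZero p).trace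

/-- the toy sequence `b`: its level-`0` entry is the Brillouin-zone mean of `toyG` (the (N) dictionary holds by `rfl`). [folklore] -/
def toyb : ℕ → ℝ := fun _ => (latticeKernel toyG 0).re

/-! ## §2 The symbol: characters, evenness, conjugation, the tube bound -/

/-- `e^{i q₀}` is the lattice character of the offset `e₀`. [folklore] -/
theorem cexp_eq_character (q : Fin 4 → ℂ) : cexp (I * q 0) = character (Pi.single 0 1) q := by
  unfold character
  congr 1
  simp [Pi.single_apply]

/-- `e^{−i q₀}` is the lattice character of the offset `−e₀`. [folklore] -/
theorem cexp_neg_eq_character (q : Fin 4 → ℂ) : cexp (-(I * q 0)) = character (-Pi.single 0 1) q := by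
  unfold character
  congr 1
  simp [Pi.single_apply]

/-- the symbol is TUBE-HOLOMORPHIC on every tube (constants + characters). [folklore] -/
theorem tubeHol_sym (w : Fin 4 → ℝ) : TubeHol sym w := by
  have e : sym = fun q => 2 + 8⁻¹ * (character (Pi.single 0 1) q + character (-Pi.single 0 1) q) := by
    funext q; rw [sym, cexp_eq_character, cexp_neg_eq_character]
  rw [e]
  exact (tubeHol_const 2 w).add (((tubeHol_character _ w).add (tubeHol_character _ w)).const_mul _)

/-- the symbol is EVEN in `q₀` and depends on no other coordinate: invariant under every coordinate reflection. [folklore] -/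
theorem sym_reflectAt (ν : Fin 4) (q : Fin 4 → ℂ) : sym (reflectAt ν q) = sym q := by
  unfold sym reflectAt
  by_cases hν : (0 : Fin 4) = ν
  · subst hν
    rw [Function.update_self, mul_neg, neg_neg, add_comm (cexp (-(I * q 0)))]
  · rw [Function.update_of_ne hν]

/-- the symbol is even: `sym (−q) = sym q`. [folklore] -/
theorem sym_neg (q : Fin 4 → ℂ) : sym (-q) = sym q := by
  unfold sym
  rw [Pi.neg_apply, mul_neg, neg_neg, add_comm (cexp (-(I * q 0)))]

/-- conjugate reflection: `sym (−q̄) = conj (sym q)` (real coefficients). [folklore] -/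
theorem sym_conjNeg (q : Fin 4 → ℂ) : sym (conjNeg q) = conj (sym q) := by
  unfold sym
  rw [conjNeg_apply, map_add, map_mul, map_add, ← Complex.exp_conj, ← Complex.exp_conj, map_neg, map_mul, Complex.conj_I]
  have e8 : conj (8⁻¹ : ℂ) = 8⁻¹ := by
    rw [map_inv₀]; norm_num [map_ofNat]
  have e2 : conj (2 : ℂ) = 2 := by norm_num [map_ofNat]
  rw [e8, e2]
  ring_nf

/-- **THE TUBE BOUND**: for `|Im q₀| ≤ 1`, `‖sym q‖ ≥ 1` (`‖e^{±i q₀}‖ ≤ e ≤ 2.72`, so `‖sym q − 2‖ ≤ e∕4 ≤ 0.68`). [folklore] -/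
theorem one_le_norm_sym {q : Fin 4 → ℂ} (hq : |(q 0).im| ≤ 1) : 1 ≤ ‖sym q‖ := by
  have he := Real.exp_one_lt_d9
  have h1 : ‖cexp (I * q 0)‖ ≤ Real.exp 1 := by
    rw [Complex.norm_exp, Complex.I_mul_re]
    exact Real.exp_le_exp.mpr (by linarith [(abs_le.mp hq).1])
  have h2 : ‖cexp (-(I * q 0))‖ ≤ Real.exp 1 := by
    rw [Complex.norm_exp, Complex.neg_re, Complex.I_mul_re, neg_neg]
    exact Real.exp_le_exp.mpr (abs_le.mp hq).2
  have h8 : ‖(8⁻¹ : ℂ) * (cexp (I * q 0) + cexp (-(I * q 0)))‖ ≤ 8⁻¹ * (Real.exp 1 + Real.exp 1) := by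
    rw [norm_mul, norm_inv, Complex.norm_ofNat]
    exact mul_le_mul_of_nonneg_left ((norm_add_le _ _).trans (add_le_add h1 h2)) (by norm_num)
  have htri : ‖(2 : ℂ)‖ ≤ ‖sym q‖ + ‖(8⁻¹ : ℂ) * (cexp (I * q 0) + cexp (-(I * q 0)))‖ := by
    have e : (2 : ℂ) = sym q - 8⁻¹ * (cexp (I * q 0) + cexp (-(I * q 0))) := by unfold sym; ring
    rw [e]
    exact norm_sub_le _ _
  rw [Complex.norm_ofNat] at htri
  linarith

/-- hence the symbol has no zero on the tube `|Im q₀| ≤ 1`. [folklore] -/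
theorem sym_ne_zero {q : Fin 4 → ℂ} (hq : |(q 0).im| ≤ 1) : sym q ≠ 0 := fun h => by
  have := one_le_norm_sym hq
  rw [h, norm_zero] at this
  exact absurd this (by norm_num)

/-! ## §3 The matrix family: structure binders, determinant, inverse, norms -/

/-- STRUCTURE `hA`: `toyA` is `MatTubeHol` on every tube. [folklore] -/
theorem matTubeHol_toyA (w : Fin 4 → ℝ) : MatTubeHol toyA w :=
  (matTubeHol_const (1 : Matrix (Fin 1) (Fin 1) ℂ) w).smul (tubeHol_sym w)

/-- STRUCTURE `MatNegTranspose`: `toyA (−q) = (toyA q)ᵀ`. [folklore] -/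
theorem matNegTranspose_toyA : MatNegTranspose toyA := fun q => by
  unfold toyA
  rw [sym_neg, Matrix.transpose_smul, Matrix.transpose_one]

/-- STRUCTURE `MatConjSymm`: `toyA (−q̄) = conj ∘ toyA q`. [folklore] -/
theorem matConjSymm_toyA : MatConjSymm toyA := fun q => by
  unfold toyA
  rw [sym_conjNeg]
  ext i j
  fin_cases i; fin_cases j
  simp

/-- the determinant of the `1 × 1` family is the symbol. [folklore] -/
theorem det_toyA (q : Fin 4 → ℂ) : (toyA q).det = sym q := by
  rw [Matrix.det_fin_one, toyA, Matrix.smul_apply, Matrix.one_apply_eq, smul_eq_mul, mul_one]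

/-- `hR`: the determinant is invariant under every coordinate reflection. [folklore] -/
theorem det_toyA_reflectAt (ν : Fin 4) (q : Fin 4 → ℂ) : (toyA (reflectAt ν q)).det = (toyA q).det := by
  rw [det_toyA, det_toyA, sym_reflectAt]

/-- the inverse on the zero-free set: `(toyA q)⁻¹ = (sym q)⁻¹ • 1`. [folklore] -/
theorem inv_toyA {q : Fin 4 → ℂ} (hq : sym q ≠ 0) : (toyA q)⁻¹ = (sym q)⁻¹ • (1 : Matrix (Fin 1) (Fin 1) ℂ) := by
  apply Matrix.inv_eq_left_inv
  rw [toyA, smul_mul_smul_comm, Matrix.one_mul, inv_mul_cancel₀ hq, one_smul]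

/-- `‖1‖ ≤ 1` for the `1 × 1` identity in the Euclidean operator norm. [folklore] -/
theorem norm_one_le : ‖(1 : Matrix (Fin 1) (Fin 1) ℂ)‖ ≤ 1 := by
  rw [← diagonal_one, l2_opNorm_diagonal]
  exact (pi_norm_le_iff_of_nonneg zero_le_one).mpr fun _ => by simp

/-- **THE LEAF CERTIFICATE OF THE TOY**: on the tube `|Im q₀| ≤ 1`, `toyA q` is invertible with `‖(toyA q)⁻¹‖ ≤ 1`. [folklore] -/
theorem cert_toyA {q : Fin 4 → ℂ} (hq : |(q 0).im| ≤ 1) : IsUnit (toyA q).det ∧ ‖(toyA q)⁻¹‖ ≤ 1 := by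
  have hne := sym_ne_zero hq
  refine ⟨by rw [det_toyA]; exact isUnit_iff_ne_zero.mpr hne, ?_⟩
  rw [inv_toyA hne, norm_smul, norm_inv]
  have h1 := one_le_norm_sym hq
  calc ‖sym q‖⁻¹ * ‖(1 : Matrix (Fin 1) (Fin 1) ℂ)‖ ≤ 1 * 1 :=
        mul_le_mul (inv_le_one_of_one_le₀ h1) norm_one_le (norm_nonneg _) zero_le_one
    _ = 1 := one_mul _

/-! ## §4 The one-loop form on real momenta and the (T) ball -/

/-- the toy one-loop form is `(sym p)⁻¹` wherever the symbol is nonzero. [folklore] -/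
theorem toyG_eq {p : Fin 4 → ℂ} (hp : sym p ≠ 0) : toyG p = (sym p)⁻¹ := by
  unfold toyG toyOne toyZero
  rw [inv_toyA hp, Matrix.mul_one, Matrix.mul_zero, Matrix.trace_zero, sub_zero, Matrix.trace_smul, Matrix.trace_one,
    Fintype.card_fin]
  simp

/-- on REAL momenta the symbol is the real number `2 + cos s₀ ∕ 4`. [folklore] -/
theorem sym_ofRealVec (s : Fin 4 → ℝ) : sym (ofRealVec s) = ((2 + Real.cos (s 0) / 4 : ℝ) : ℂ) := by
  unfold sym ofRealVec
  rw [Complex.ofReal_add, Complex.ofReal_div, Complex.ofReal_cos, Complex.cos]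
  push_cast
  ring_nf

/-- POINTWISE: at every real momentum `|toyG − 1∕2| ≤ 1∕10` (indeed `≤ 1∕14`: `toyG = (2 + cos s₀∕4)⁻¹ ∈ [4∕9, 4∕7]`). [folklore] -/
theorem norm_toyG_ofRealVec_sub_half_le (s : Fin 4 → ℝ) : ‖toyG (ofRealVec s) - ((1 / 2 : ℝ) : ℂ)‖ ≤ 1 / 10 := by
  set u : ℝ := 2 + Real.cos (s 0) / 4 with hu
  have hcos := Real.abs_cos_le_one (s 0)
  have hu1 : 7 / 4 ≤ u := by rw [hu]; linarith [(abs_le.mp hcos).1]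
  have hu2 : u ≤ 9 / 4 := by rw [hu]; linarith [(abs_le.mp hcos).2]
  have hu0 : u ≠ 0 := by linarith
  have hne : sym (ofRealVec s) ≠ 0 := by
    rw [sym_ofRealVec]; exact_mod_cast hu0
  rw [toyG_eq hne, sym_ofRealVec, ← hu, ← Complex.ofReal_inv, ← Complex.ofReal_sub, Complex.norm_real, Real.norm_eq_abs]
  have e : u⁻¹ - 1 / 2 = (2 - u) / (2 * u) := by field_simp
  rw [e, abs_div, abs_of_pos (by linarith : (0 : ℝ) < 2 * u), div_le_iff₀ (by linarith)]
  have : |2 - u| ≤ 1 / 4 := abs_le.mpr ⟨by linarith, by linarith⟩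
  linarith

/-- the positive integer `4 · 2`. [folklore] -/
instance neZero_four_mul_two : NeZero (4 * 2) := ⟨by norm_num⟩

/-- **THE (T) BALL OF THE TOY**: the code16 `N = 2` mean (256 nodes) of `toyG` is within `1∕10` of `1∕2` — from the pointwise bound, no node
evaluated. [folklore] -/
theorem toy_hT : ‖((code16SetE 2).card : ℂ)⁻¹ * (∑ w ∈ code16SetE 2, descend toyG (gridPt (4 * 2) w)) - ((1 / 2 : ℝ) : ℂ)‖ ≤ 1 / 10 := by
  have hcard : ((code16SetE 2).card : ℂ) = 256 := by rw [card_code16SetE]; norm_num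
  have e : ((code16SetE 2).card : ℂ)⁻¹ * (∑ w ∈ code16SetE 2, descend toyG (gridPt (4 * 2) w)) - ((1 / 2 : ℝ) : ℂ)
      = ((code16SetE 2).card : ℂ)⁻¹ * ∑ w ∈ code16SetE 2, (descend toyG (gridPt (4 * 2) w) - ((1 / 2 : ℝ) : ℂ)) := by
    rw [Finset.sum_sub_distrib, Finset.sum_const, nsmul_eq_mul, mul_sub, hcard]
    congr 1
    field_simp
  rw [e, norm_mul, norm_inv, hcard, Complex.norm_ofNat]
  have hsum : ‖∑ w ∈ code16SetE 2, (descend toyG (gridPt (4 * 2) w) - ((1 / 2 : ℝ) : ℂ))‖ ≤ ∑ w ∈ code16SetE 2, (1 / 10 : ℝ) := by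
    refine (norm_sum_le _ _).trans (Finset.sum_le_sum fun w _ => ?_)
    rw [B4TorusKernel.descend_gridPt]
    exact norm_toyG_ofRealVec_sub_half_le _
  rw [Finset.sum_const, card_code16SetE, nsmul_eq_mul] at hsum
  norm_num at hsum ⊢
  linarith

/-! ## §5 The budget and the remaining small binders -/

/-- the alias ratio at `κ = 1`, `N = 2`: `e^{−2} ≤ 3∕19` (`= (1 + 2 + 2 + 4∕3)⁻¹`). [folklore] -/
theorem aliasRatioL1_one_two_le : aliasRatioL1 1 2 ≤ 3 / 19 := by
  refine (aliasRatioL1_le_inv_partialSum (by norm_num) 2 (by norm_num : 1 ≤ 4)).trans ?_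
  rw [show ((1 : ℝ) * (2 : ℕ)) = 2 by push_cast; norm_num]
  simp only [Finset.sum_range_succ, Finset.sum_range_zero, Nat.factorial]
  norm_num

/-- **THE (A) BUDGET OF THE TOY**: `card (Fin 1) · (1·1 + 1·0·1·0) · codeTheta(e^{−2}) ≤ 3∕100` (`38 · (3∕19)⁴ = 0.0236…`). [folklore] -/
theorem toy_hA₀ : (Fintype.card (Fin 1) : ℝ) * (1 * 1 + 1 * 0 * 1 * 0) * codeTheta (aliasRatioL1 1 2) ≤ 3 / 100 := by
  have h := budget_code16_param (κ := 1) (N := 2) (M := 1) (τ := 3 / 100) zero_le_one aliasRatioL1_one_two_le (by norm_num)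
    (by norm_num)
  rw [Fintype.card_fin]
  simpa using h

/-- (Z2b) for `B = 1`: `‖1‖ ≤ 1` on the vertex tori. [folklore] -/
theorem toy_hSst : ∀ p ∈ VertexTori (fun _ : Fin (3 + 1) => (1 : ℝ)), ‖toyOne p‖ ≤ 1 := fun _ _ => norm_one_le

/-- (Z2b) for `C = D = 0`: `‖0‖ ≤ 0`. [folklore] -/
theorem toy_hS0 : ∀ p ∈ VertexTori (fun _ : Fin (3 + 1) => (1 : ℝ)), ‖toyZero p‖ ≤ 0 := fun _ _ => by simp [toyZero]

/-- the per-leaf box certificates `hcert` (schedules := `leaf`; any schedule would do): every box lies on a vertex torus, where `|Im q₀| = 1`.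
[folklore] -/
theorem toy_hcert (ν₀ ν₁ : Fin (3 + 1)) (S : (Fin (3 + 1) → Bool) → Sched 3) :
    ∀ bx ∈ quarterBoxes (fun _ : Fin (3 + 1) => (1 : ℝ)) ν₀ ν₁ S, ∀ q ∈ Box bx.1 bx.2, IsUnit (toyA q).det ∧ ‖(toyA q)⁻¹‖ ≤ 1 := by
  intro bx hbx q hq
  have hV := (quarterBoxes_subset (fun _ => zero_le_one) hbx hq).1
  exact cert_toyA (le_of_eq (hV 0).2)

/-- the per-leaf fin certificates `hcertF` (fin schedules arbitrary): at a fin point `Im p₀ = τκ = τ ∈ [0, 1]`. [folklore] -/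
theorem toy_hcertF (F : Fin (3 + 1) → Sched 1) :
    ∀ (i : Fin (3 + 1)), ∀ bx ∈ finRects (F i), ∀ τ x : ℝ, |τ - bx.1 0| ≤ bx.2 0 → |x - bx.1 1| ≤ bx.2 1 →
      IsUnit (toyA (i.insertNth ((x : ℂ) + ((τ * 1 : ℝ) : ℂ) * I) fun _ => ((τ * 1 : ℝ) : ℂ) * I)).det := by
  intro i bx hbx τ x hτ hx
  have hτ01 := (finRects_subset (F i) hbx hτ hx).1
  refine (cert_toyA ?_).1
  have him : ∀ μ, ((i.insertNth ((x : ℂ) + ((τ * 1 : ℝ) : ℂ) * I) (fun _ => ((τ * 1 : ℝ) : ℂ) * I) : Fin 4 → ℂ) μ).im = τ := by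
    intro μ
    refine Fin.succAboveCases i ?_ (fun j => ?_) μ
    · rw [Fin.insertNth_apply_same]; simp
    · rw [Fin.insertNth_apply_succAbove]; simp
  rw [him 0, abs_of_nonneg hτ01.1]
  exact hτ01.2

/-! ## §6 The typed target INHABITED, and its certified row read back -/

/-- **ROW CAP-k's TYPED TARGET INHABITED WITH NO HYPOTHESIS** (toy family, `κ = 1`, code16 `N = 2`, `t = 1∕2`, `r = 1∕10`, `A₀ = 3∕100`,
`lo = 1∕3`; box and fin schedules := `leaf`). [folklore] -/
def toyRows : Rows toyb :=
  rowsOfOneLoopFormCode16E_routeA₂_ofSchedules (b := toyb) (A := toyA) (B := toyOne) (C := toyZero) (D := toyZero) (κ := 1) (Ba := 1)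
    (Sst := 1) (Ss := 0) (St := 0) (c := 0) rfl one_pos (fun _ => by simp) (matTubeHol_toyA _)
    (by simpa only [sub_zero] using matTubeHol_toyA _) (matTubeHol_const _ _) (matTubeHol_const _ _) (matTubeHol_const _ _)
    matNegTranspose_toyA matConjSymm_toyA 0 0 (fun _ => Sched.leaf) (toy_hcert 0 0 _) det_toyA_reflectAt (fun _ => Sched.leaf)
    (toy_hcertF _) toy_hSst toy_hS0 toy_hS0 (N := 2) (by norm_num) toy_hT toy_hA₀ (1 / 3) (by norm_num)

/-- its level is `k₀ = 0`. [folklore] -/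
theorem toyRows_k₀ : toyRows.k₀ = 0 := rowsOfOneLoopFormCode16E_routeA₂_ofSchedules_k₀ ..

/-- its certified row is `lo 0 = 1∕3`. [folklore] -/
theorem toyRows_lo : toyRows.lo 0 = 1 / 3 := rfl

/-- **THE CERTIFIED ROW READ BACK**: `1∕3 ≤ Re ∫_{BZ} toyG dq∕(2π)⁴` — a closed kernel inequality about a Brillouin-zone mean, produced by the
row's whole chain (structure → symmetry transports → covers → maximum principle → code16 aliasing tail → budget). [folklore] -/
theorem third_le_latticeKernel_toy : (1 / 3 : ℝ) ≤ (latticeKernel toyG 0).re := by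
  have h := toyRows.lo_le 0 (by rw [toyRows_k₀])
  rw [toyRows_lo] at h
  simpa [toyb] using h

end

end Summit.QuantumFields.BalabanUV.Beta.CapRouteAToy
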